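import Mathlib

/-!
# Galerkin duality for linear functionals (finite-dimensional Aubin–Nitsche / goal-oriented identity; DEQ-A178)

HONEST FRAMING: instance-level adjudication of specific advantage claims; no claim about
BQP vs BPP or the summit.

Lane receipt written by unit pub-qadeq-deq-1 (gen 31) and filed through the gate by the cell lead
(pub-qadeq-harvest-1 gen 21); staging copy `pub-qadeq-deq-1/GalerkinDuality.lean`.

Context (cell pub-qadeq, claim A-178 = Deiml–Peterseim, "Quantum realization of the finite element
method", Math. Comp. 2025, arXiv:2403.19512v4, Thm 6.5 / Rem 6.7: a quantum algorithm outputs ONE linear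
functional `mᵀ c` of the Q1 finite element solution `S c = r` to tolerance `tol` in `Õ(tol⁻¹)`, and the
printed classical baseline is `tol^{-d}` from the mesh choice `h ≈ tol`, i.e. from the ENERGY-norm error).
DEQ-A178.md (unit pub-qadeq-deq-1) prices the classical cost of the SAME deliverable through the identity
below: the error of a linear functional of a Galerkin solution equals the energy inner product of the primal
Galerkin error with the dual Galerkin error, hence is bounded by the PRODUCT of the two energy-norm errors
(`O(h) · O(h) = O(h²)` under the paper's hypotheses `f, m ∈ L²`, `∇A ∈ L^∞`, convex `D`), so that the
classical mesh is `h ≈ tol^{1/2}` and the number of unknowns `tol^{-d/2}` (Montanaro–Pallister 2016, the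
paper's ref. [50], §2.3, reach the same count via the `L²` estimate).

Setting: `S : Matrix n n ℝ` symmetric (stiffness matrix of a symmetric bilinear form on the fine space
`ℝⁿ`), `P : Matrix n k ℝ` (prolongation from a coarse space `ℝᵏ`; its columns span the Galerkin subspace),
fine primal / dual solutions `S c = r`, `S z = m`, coarse (Galerkin) primal solution `(Pᵀ S P) c_H = Pᵀ r`,
and an ARBITRARY coarse vector `z_H` (the bound is optimised by the dual Galerkin solution).

* `functional_error_eq` : `m ⬝ (c - P c_H) = (z - P z_H) ⬝ S (c - P c_H)`;
* `functional_error_sq_le` : if `S` is positive semidefinite,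
  `(m ⬝ (c - P c_H))² ≤ ((c - P c_H) ⬝ S (c - P c_H)) · ((z - P z_H) ⬝ S (z - P z_H))`;
* `functional_error_abs_le` : the same with square roots (product of the two energy-norm errors).

All statements are `[folklore]` linear algebra (Galerkin orthogonality + Cauchy–Schwarz for a positive
semidefinite form); Mathlib has the matrix API but not these packaged statements.  Mathlib-only, no `def`,
no named fact, no `sorry`.
-/

namespace Summit.QuantumAdvantage.Dequantization.GalerkinDuality

open Matrix

variable {n k : Type*} [Fintype n] [Fintype k]

/-- A symmetric matrix moves across the dot product: `u ⬝ (S v) = (S u) ⬝ v`. [folklore] -/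
theorem dotProduct_mulVec_of_isSymm {S : Matrix n n ℝ} (hS : S.IsSymm) (u v : n → ℝ) :
    u ⬝ᵥ S *ᵥ v = (S *ᵥ u) ⬝ᵥ v := by
  rw [dotProduct_mulVec, ← mulVec_transpose, hS.eq]

/-- The transpose is the adjoint for the dot product: `(P x) ⬝ w = x ⬝ (Pᵀ w)`. [folklore] -/
theorem mulVec_dotProduct_eq_dotProduct_transpose_mulVec (P : Matrix n k ℝ) (x : k → ℝ) (w : n → ℝ) :
    (P *ᵥ x) ⬝ᵥ w = x ⬝ᵥ Pᵀ *ᵥ w := by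
  rw [dotProduct_mulVec, vecMul_transpose]

/-- **Galerkin orthogonality**: the residual of the Galerkin solution is orthogonal to the coarse space,
`Pᵀ S (c - P c_H) = 0`. [folklore] -/
theorem galerkin_orthogonality (S : Matrix n n ℝ) (P : Matrix n k ℝ) {r c : n → ℝ} {cH : k → ℝ}
    (hc : S *ᵥ c = r) (hcH : (Pᵀ * S * P) *ᵥ cH = Pᵀ *ᵥ r) :
    Pᵀ *ᵥ (S *ᵥ (c - P *ᵥ cH)) = 0 := by
  rw [mulVec_sub, mulVec_sub, hc, mulVec_mulVec, mulVec_mulVec, hcH, sub_self]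

/-- **Galerkin duality identity** (finite-dimensional Aubin–Nitsche / dual-weighted-residual identity):
for symmetric `S`, fine solutions `S c = r`, `S z = m`, the Galerkin solution `c_H` of
`(Pᵀ S P) c_H = Pᵀ r` and ANY coarse vector `z_H`,
`m ⬝ (c - P c_H) = (z - P z_H) ⬝ S (c - P c_H)`:
the error of the linear functional `m ⬝ ·` is the `S`-inner product of the primal error with the dual
error. [folklore] -/
theorem functional_error_eq {S : Matrix n n ℝ} (hS : S.IsSymm) (P : Matrix n k ℝ)
    {r m c z : n → ℝ} {cH : k → ℝ}
    (hc : S *ᵥ c = r) (hz : S *ᵥ z = m) (hcH : (Pᵀ * S * P) *ᵥ cH = Pᵀ *ᵥ r) (zH : k → ℝ) :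
    m ⬝ᵥ (c - P *ᵥ cH) = (z - P *ᵥ zH) ⬝ᵥ S *ᵥ (c - P *ᵥ cH) := by
  have horth := galerkin_orthogonality S P hc hcH
  calc m ⬝ᵥ (c - P *ᵥ cH) = (S *ᵥ z) ⬝ᵥ (c - P *ᵥ cH) := by rw [hz]
    _ = z ⬝ᵥ S *ᵥ (c - P *ᵥ cH) := by rw [dotProduct_mulVec_of_isSymm hS]
    _ = z ⬝ᵥ S *ᵥ (c - P *ᵥ cH) - (P *ᵥ zH) ⬝ᵥ S *ᵥ (c - P *ᵥ cH) := by
          rw [mulVec_dotProduct_eq_dotProduct_transpose_mulVec, horth, dotProduct_zero, sub_zero]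
    _ = (z - P *ᵥ zH) ⬝ᵥ S *ᵥ (c - P *ᵥ cH) := by rw [sub_dotProduct]

/-- **Cauchy–Schwarz for a positive semidefinite symmetric form**: `(uᵀ S v)² ≤ (uᵀ S u)(vᵀ S v)`.
[folklore] -/
theorem dotProduct_mulVec_sq_le_mul {S : Matrix n n ℝ} (hS : S.IsSymm) (hpsd : ∀ e, 0 ≤ e ⬝ᵥ S *ᵥ e)
    (u v : n → ℝ) : (u ⬝ᵥ S *ᵥ v) ^ 2 ≤ (u ⬝ᵥ S *ᵥ u) * (v ⬝ᵥ S *ᵥ v) := by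
  -- `0 ≤ (u - t v)ᵀ S (u - t v) = vᵀSv t² - 2 uᵀSv t + uᵀSu` for every `t`, so the discriminant is `≤ 0`.
  have hsym : v ⬝ᵥ S *ᵥ u = u ⬝ᵥ S *ᵥ v := by
    rw [dotProduct_mulVec_of_isSymm hS, dotProduct_comm]
  have hq : ∀ t : ℝ, 0 ≤ (v ⬝ᵥ S *ᵥ v) * (t * t) + (-2 * (u ⬝ᵥ S *ᵥ v)) * t + u ⬝ᵥ S *ᵥ u := by
    intro t
    have h := hpsd (u - t • v)
    have hexp : (u - t • v) ⬝ᵥ S *ᵥ (u - t • v) =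
        (v ⬝ᵥ S *ᵥ v) * (t * t) + (-2 * (u ⬝ᵥ S *ᵥ v)) * t + u ⬝ᵥ S *ᵥ u := by
      simp only [mulVec_sub, mulVec_smul, sub_dotProduct, dotProduct_sub, dotProduct_smul, smul_dotProduct,
        smul_eq_mul, hsym]
      ring
    rwa [hexp] at h
  have hd := discrim_le_zero hq
  rw [discrim] at hd
  nlinarith

/-- **Functional error ≤ product of energy errors (squared form)**: for symmetric positive semidefinite
`S`, `(m ⬝ (c - P c_H))² ≤ ‖c - P c_H‖_S² · ‖z - P z_H‖_S²` for ANY coarse `z_H`; with `z_H` the dual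
Galerkin solution both factors are Galerkin (energy-norm) errors, each `O(h)` for Q1 elements under
`H²`-regularity, so the functional converges at rate `h²`. [folklore] -/
theorem functional_error_sq_le {S : Matrix n n ℝ} (hS : S.IsSymm) (hpsd : ∀ e, 0 ≤ e ⬝ᵥ S *ᵥ e)
    (P : Matrix n k ℝ) {r m c z : n → ℝ} {cH : k → ℝ}
    (hc : S *ᵥ c = r) (hz : S *ᵥ z = m) (hcH : (Pᵀ * S * P) *ᵥ cH = Pᵀ *ᵥ r) (zH : k → ℝ) :
    (m ⬝ᵥ (c - P *ᵥ cH)) ^ 2 ≤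
      ((c - P *ᵥ cH) ⬝ᵥ S *ᵥ (c - P *ᵥ cH)) * ((z - P *ᵥ zH) ⬝ᵥ S *ᵥ (z - P *ᵥ zH)) := by
  rw [functional_error_eq hS P hc hz hcH zH, mul_comm]
  exact dotProduct_mulVec_sq_le_mul hS hpsd _ _

/-- **Functional error ≤ product of energy-norm errors**:
`|m ⬝ (c - P c_H)| ≤ √((c - P c_H)ᵀ S (c - P c_H)) · √((z - P z_H)ᵀ S (z - P z_H))`. [folklore] -/
theorem functional_error_abs_le {S : Matrix n n ℝ} (hS : S.IsSymm) (hpsd : ∀ e, 0 ≤ e ⬝ᵥ S *ᵥ e)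
    (P : Matrix n k ℝ) {r m c z : n → ℝ} {cH : k → ℝ}
    (hc : S *ᵥ c = r) (hz : S *ᵥ z = m) (hcH : (Pᵀ * S * P) *ᵥ cH = Pᵀ *ᵥ r) (zH : k → ℝ) :
    |m ⬝ᵥ (c - P *ᵥ cH)| ≤
      Real.sqrt ((c - P *ᵥ cH) ⬝ᵥ S *ᵥ (c - P *ᵥ cH)) * Real.sqrt ((z - P *ᵥ zH) ⬝ᵥ S *ᵥ (z - P *ᵥ zH)) := by
  rw [← Real.sqrt_mul (hpsd _)]
  exact Real.abs_le_sqrt (functional_error_sq_le hS hpsd P hc hz hcH zH)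

end Summit.QuantumAdvantage.Dequantization.GalerkinDuality
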